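import Mathlib.Combinatorics.SetFamily.FourFunctions
import Mathlib.Tactic
import HarnessLib
import HarnessLib.Audit.Tags
import Summits.CriticalPhenomena.PercolationContinuityZ3.Theorems.PercNearOneGluingNoHeavyLowerTailSahiColouredDaykin
import Summits.CriticalPhenomena.PercolationContinuityZ3.Theorems.PercNearOneGluingNoHeavyLowerTailSahiColouredDaykinCross

/-!
# Crossing signed coloured Daykin: the "third class is free" conjecture Z_min and its reduction

Support file (seat `prim-masterthm-p1`, gen 29; `--supports stmt-CriticalPhenomena-4575`).  One definition (`thirdFreeFamily`), one typed conjecture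
(`CrossThirdClassFree`), one reduction; no `sorry`, standard axioms.  Memo `run/shared/lean/prim/prim-masterthm/FROM-prim-masterthm-p1-g29-MS-EQUALITY.md` §7.

CONTEXT.  `CrossSignedColouredDaykin3` (tree `…SahiColouredDaykinCross`) asks `#P ≤ #compatJoins F P c` for crossing three-colour configurations.  Passing to
complements, `compatJoins` corresponds to `D(Q₀₁) ∪ D(Q₁₂) ∪ D(Q₂₀)` where `Q_{ab} = P_a ∪ P̃_b` (`X̃ = F ∖ X`) and `D(Q) = Q \\ Q`; gen 29 proved
`#(Q_{ab} \\ Q_{ab}) ≥ #P_a + #P_b + 1` (strict Marica–Schönheim, `…SahiMSEquality`), which settles the case of a singleton third class.  The census of gen 29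
(memo §7: all 48 / 10 320 crossing configurations of `2^4` / `2^5`, ≈52 000 random ones of `2^6`, `2^7`, tight cases with third classes of sizes 2–4) supports
the sharper statement that the cross terms with a SMALLEST class are never needed:

* `CrossThirdClassFree` (**conjecture Z_min**): if colour `i` is a smallest class then `#P ≤ #((Q \\ Q) ∪ (P_i \\ P_i))` with `Q = P_{i+1} ∪ P̃_{i+2}`.
  For `#P_i = 1` this is exactly strict Marica–Schönheim; with `i` a LARGEST class it is false (`P₀ = {0134, 013}, P₁ = {012}, P₂ = {035}` in `2^6`), and
  without the crossing hypotheses it is false (`{12} | {014} | {3, 23}`).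
* `crossSignedColouredDaykin3_of_crossThirdClassFree`: **Z_min ⟹ `CrossSignedColouredDaykin3`** (complements of the differences of `Q` and of `P_i` are compatible
  unions).  HONEST FRAMING: a typed conjecture and a reduction; nothing new is proved unconditionally here. [this work]
-/

namespace Summit.CriticalPhenomena.PercolationContinuityZ3.Theorems.SahiColouredDaykin

open Finset
open scoped FinsetFamily

variable {α : Type*} [DecidableEq α]

/-- The two-colour family attached to colour `i`: members of colour `i + 1` together with the complements (in `F`) of the members of colour `i + 2`. [this work] -/
def thirdFreeFamily (F : Finset α) (P : Finset (Finset α)) (c : Finset α → Fin 3) (i : Fin 3) : Finset (Finset α) :=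
  (P.filter fun S => c S = i + 1) ∪ ((P.filter fun S => c S = i + 2).image fun S => F \ S)

/-- **CONJECTURE Z_min ("the third class is free").**  In a crossing three-colour configuration, if colour `i` is a smallest class then the differences of
`Q = P_{i+1} ∪ P̃_{i+2}` together with the differences inside `P_i` already number at least `#P`.  Exhaustive on `2^4, 2^5`; no failure among ≈52 000 random
crossing configurations of `2^6, 2^7`; the singleton case is strict Marica–Schönheim (gen 29). [this work] [status: open] -/
@[conjecture] def CrossThirdClassFree (α : Type*) [DecidableEq α] : Prop :=
  ∀ (F : Finset α) (P : Finset (Finset α)) (c : Finset α → Fin 3) (i : Fin 3),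
    (∀ S ∈ P, S ⊆ F) →
    (∀ S ∈ P, ∀ T ∈ P, c S ≠ c T → ¬ S ⊆ T) →
    (∀ S ∈ P, ∀ T ∈ P, (S ∩ T).Nonempty ∧ S ∪ T ≠ F) →
    (∀ j : Fin 3, #(P.filter fun S => c S = i) ≤ #(P.filter fun S => c S = j)) →
    #P ≤ #((thirdFreeFamily F P c i \\ thirdFreeFamily F P c i) ∪ ((P.filter fun S => c S = i) \\ (P.filter fun S => c S = i)))

/-- Complementation inside `F` is injective on subfamilies of `2^F`. [folklore] -/
private theorem sdiff_injOn_of_subset (F : Finset α) (𝒜 : Finset (Finset α)) (h𝒜 : ∀ S ∈ 𝒜, S ⊆ F) :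
    Set.InjOn (fun S => F \ S) ↑𝒜 := by
  intro S hS S' hS' h
  have hSF := h𝒜 S (mem_coe.1 hS)
  have hS'F := h𝒜 S' (mem_coe.1 hS')
  have : F \ (F \ S) = F \ (F \ S') := by
    show F \ ((fun S => F \ S) S) = F \ ((fun S => F \ S) S')
    rw [h]
  rwa [Finset.sdiff_sdiff_eq_self hSF, Finset.sdiff_sdiff_eq_self hS'F] at this

/-- Every difference of `Q = P_a ∪ P̃_b` (`a ≠ b`) and every difference inside one colour class lies in `2^F` and has its complement among the compatible
unions. [this work] -/
private theorem compl_mem_compatJoins_of_mem (F : Finset α) (P : Finset (Finset α)) (c : Finset α → Fin 3) (a b : Fin 3) (hab : a ≠ b)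
    (hPF : ∀ S ∈ P, S ⊆ F) {Z : Finset α}
    (hZ : Z ∈ (((P.filter fun S => c S = a) ∪ ((P.filter fun S => c S = b).image fun S => F \ S)) \\
            ((P.filter fun S => c S = a) ∪ ((P.filter fun S => c S = b).image fun S => F \ S))) ∪
          ((P.filter fun S => c S = a + 2) \\ (P.filter fun S => c S = a + 2))) :
    Z ⊆ F ∧ F \ Z ∈ compatJoins F P c := by
  rcases mem_union.1 hZ with hZ | hZ
  · obtain ⟨X, hX, Y, hY, rfl⟩ := mem_diffs.1 hZ
    rcases mem_union.1 hX with hX | hX <;> rcases mem_union.1 hY with hY | hY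
    · obtain ⟨haP, hai⟩ := mem_filter.1 hX
      obtain ⟨ha'P, ha'i⟩ := mem_filter.1 hY
      refine ⟨sdiff_subset.trans (hPF X haP), ?_⟩
      have e : F \ (X \ Y) = Y ∪ (F \ X) := by
        ext x
        have h1 : x ∈ Y → x ∈ F := fun h => hPF Y ha'P h
        simp only [mem_sdiff, mem_union]
        tauto
      rw [e]
      exact union_sdiff_mem_compatJoins ha'P haP (by rw [ha'i, hai])
    · obtain ⟨haP, hai⟩ := mem_filter.1 hX
      obtain ⟨bb, hb, rfl⟩ := mem_image.1 hY
      obtain ⟨hbP, hbj⟩ := mem_filter.1 hb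
      refine ⟨sdiff_subset.trans (hPF X haP), ?_⟩
      have e : F \ (X \ (F \ bb)) = (F \ X) ∪ (F \ bb) := by
        ext x
        have h1 : x ∈ X → x ∈ F := fun h => hPF X haP h
        simp only [mem_sdiff, mem_union]
        tauto
      rw [e]
      exact sdiff_union_sdiff_mem_compatJoins haP hbP (by rw [hai, hbj]; exact hab)
    · obtain ⟨bb, hb, rfl⟩ := mem_image.1 hX
      obtain ⟨hbP, hbj⟩ := mem_filter.1 hb
      obtain ⟨haP, hai⟩ := mem_filter.1 hY
      refine ⟨sdiff_subset.trans sdiff_subset, ?_⟩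
      have e : F \ ((F \ bb) \ Y) = Y ∪ bb := by
        ext x
        have h1 : x ∈ Y → x ∈ F := fun h => hPF Y haP h
        have h2 : x ∈ bb → x ∈ F := fun h => hPF bb hbP h
        simp only [mem_sdiff, mem_union]
        tauto
      rw [e]
      exact union_mem_compatJoins haP hbP (by rw [hai, hbj]; exact hab)
    · obtain ⟨bb, hb, rfl⟩ := mem_image.1 hX
      obtain ⟨hbP, hbj⟩ := mem_filter.1 hb
      obtain ⟨b', hb', rfl⟩ := mem_image.1 hY
      obtain ⟨hb'P, hb'j⟩ := mem_filter.1 hb'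
      refine ⟨sdiff_subset.trans sdiff_subset, ?_⟩
      have e : F \ ((F \ bb) \ (F \ b')) = bb ∪ (F \ b') := by
        ext x
        have h2 : x ∈ bb → x ∈ F := fun h => hPF bb hbP h
        simp only [mem_sdiff, mem_union]
        tauto
      rw [e]
      exact union_sdiff_mem_compatJoins hbP hb'P (by rw [hbj, hb'j])
  · obtain ⟨X, hX, Y, hY, rfl⟩ := mem_diffs.1 hZ
    obtain ⟨hXP, hXi⟩ := mem_filter.1 hX
    obtain ⟨hYP, hYi⟩ := mem_filter.1 hY
    refine ⟨sdiff_subset.trans (hPF X hXP), ?_⟩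
    have e : F \ (X \ Y) = Y ∪ (F \ X) := by
      ext x
      have h1 : x ∈ Y → x ∈ F := fun h => hPF Y hYP h
      simp only [mem_sdiff, mem_union]
      tauto
    rw [e]
    exact union_sdiff_mem_compatJoins hYP hXP (by rw [hYi, hXi])

/-- **Z_min ⟹ `CrossSignedColouredDaykin3`.** [this work] -/
theorem crossSignedColouredDaykin3_of_crossThirdClassFree (h : CrossThirdClassFree α) : CrossSignedColouredDaykin3 α := by
  intro F P c hPF hinc hcross
  classical
  -- a smallest colour class
  obtain ⟨i, -, hi⟩ := exists_min_image (univ : Finset (Fin 3)) (fun j => #(P.filter fun S => c S = j)) univ_nonempty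
  have hmin : ∀ j : Fin 3, #(P.filter fun S => c S = i) ≤ #(P.filter fun S => c S = j) := fun j => hi j (mem_univ j)
  have hZ := h F P c i hPF hinc hcross hmin
  set U := (thirdFreeFamily F P c i \\ thirdFreeFamily F P c i) ∪ ((P.filter fun S => c S = i) \\ (P.filter fun S => c S = i)) with hU
  have h12 : i + 1 ≠ i + 2 := by
    have : ∀ x : Fin 3, x + 1 ≠ x + 2 := by decide
    exact this i
  have hi2 : i = i + 1 + 2 := by
    have : ∀ x : Fin 3, x = x + 1 + 2 := by decide
    exact this i
  have hmem : ∀ Z ∈ U, Z ⊆ F ∧ F \ Z ∈ compatJoins F P c := by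
    intro Z hZU
    apply compl_mem_compatJoins_of_mem F P c (i + 1) (i + 2) h12 hPF
    rw [← hi2]
    exact hZU
  have hinj : Set.InjOn (fun Z => F \ Z) ↑U := sdiff_injOn_of_subset F U fun Z hZ => (hmem Z hZ).1
  have hsub : U.image (fun Z => F \ Z) ⊆ compatJoins F P c := by
    intro W hW
    obtain ⟨Z, hZ', rfl⟩ := mem_image.1 hW
    exact (hmem Z hZ').2
  calc #P ≤ #U := hZ
    _ = #(U.image fun Z => F \ Z) := (card_image_of_injOn hinj).symm
    _ ≤ #(compatJoins F P c) := card_le_card hsub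

end Summit.CriticalPhenomena.PercolationContinuityZ3.Theorems.SahiColouredDaykin
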